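import Mathlib

/-!
# Prime-order twist separation (PTS) — the combinatorial core of the lens-1-g17 engine «RRS»
# (route `PrimeTwistSeparationLadder`, crux `CriticalPrimeDegreeDescent`, stub₁ of both birth skeletons)

Setting (memo `lens-1-g17-PrimeTwistSeparationLadder.md` §3, step R3).  `Ω` = the full eigenvalue multiset of
`M(Frob_w)` (`M = R|Γ_K`, `w` a marked place of `K` of degree one over a completely split controlled `u` of `K₀`);
`S ≤ Ω` the (transported) Satake multiset of `π` at `w`; `Ω = ∑_{i ∈ I} E i` its decomposition along the
constituents `θ_i` of `M`; `ξ` a primitive `m`-th root of unity (`m` prime, `m > n·d`), `c i < m` the exponent with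
`κ_i(Frob_w) = ξ^{c i}`.  Computing the eigenvalues of `M_ν(Frob_w)` (`M_ν = R_ν|Γ_K`, `ν` the test twist with
`ν(ϖ_w) = ζ`, `ν = 1` at the other places above `u`) in the two available ways gives the identity `hT`.  GENERICITY
`hgen` (no two elements of `Ω` differ by a non-trivial power `ξ^k`, `0 < k < m` — arranged by taking `m` larger than
the order of every root of unity among the ratios of elements of `Ω`) makes the «tagging» `(k, e) ↦ ξ^k e` injective on
`[0,m) × Ω`, so the identity can be read off tag by tag: THE MARKED BLOCK IS A SUB-SUM OF CONSTITUENTS,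
`S = ∑_{c i = 1} E i` — i.e. `Sat_w(π) = Eig N_ν(Frob_w)` with `N_ν := ⊕_{c i = 1} θ_i ≤ M`.

Pure multiset algebra over a field; Mathlib only; no `sorry`.  Landed by decomp-langlands census-1 g20 from the lens-1-g17 kit
`nodes/lens-1-g17-PrimeTwistSeparationLadder.PTS.lean` (RUNME §3 I-L1g17.1; `--supports stmt-Langlands-28143`), verbatim except that the
closing `True` remark is a comment.
-/

set_option linter.dupNamespace false -- project-wide option; `Summit.Langlands.Langlands` is the mandated namespace

namespace Summit.Langlands.Langlands.Theorems.PrimeTwistSeparationLadderPTS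

open Multiset

/-- `Multiset.map` through a finite sum of multisets. [folklore] -/
theorem map_finset_sum {α β ι : Type*} (f : α → β) (I : Finset ι) (g : ι → Multiset α) :
    (∑ i ∈ I, g i).map f = ∑ i ∈ I, (g i).map f := by
  induction I using Finset.cons_induction with
  | empty => simp
  | cons a s ha ih => rw [Finset.sum_cons, Finset.sum_cons, Multiset.map_add, ih]

/-- `Multiset.filter` through a finite sum of multisets. [folklore] -/
theorem filter_finset_sum {α ι : Type*} (p : α → Prop) [DecidablePred p] (I : Finset ι)
    (g : ι → Multiset α) : (∑ i ∈ I, g i).filter p = ∑ i ∈ I, (g i).filter p := by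
  induction I using Finset.cons_induction with
  | empty => simp
  | cons a s ha ih => rw [Finset.sum_cons, Finset.sum_cons, Multiset.filter_add, ih]

/-- Membership in a finite sum of multisets. [folklore] -/
theorem mem_finset_sum {α ι : Type*} (I : Finset ι) (g : ι → Multiset α) (a : α) :
    a ∈ ∑ i ∈ I, g i ↔ ∃ i ∈ I, a ∈ g i := by
  induction I using Finset.cons_induction with
  | empty => simp
  | cons b s hb ih =>
    rw [Finset.sum_cons, Multiset.mem_add, ih]
    constructor
    · rintro (h | ⟨i, hi, h⟩)
      · exact ⟨b, Finset.mem_cons_self b s, h⟩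
      · exact ⟨i, Finset.mem_cons_of_mem hi, h⟩
    · rintro ⟨i, hi, h⟩
      rcases Finset.mem_cons.mp hi with rfl | hi
      · exact Or.inl h
      · exact Or.inr ⟨i, hi, h⟩

/-- Counting through a map that is injective on a predicate containing the multiset. [folklore] -/
theorem count_map_of_injOn {α β : Type*} [DecidableEq α] [DecidableEq β] (f : α → β) (P : α → Prop)
    (hf : ∀ a b, P a → P b → f a = f b → a = b) (s : Multiset α) (hs : ∀ y ∈ s, P y)
    (x : α) (hx : P x) : (s.map f).count (f x) = s.count x := by
  induction s using Multiset.induction_on with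
  | empty => simp
  | cons a s ih =>
    have ha : P a := hs a (Multiset.mem_cons_self a s)
    have hs' : ∀ y ∈ s, P y := fun y hy => hs y (Multiset.mem_cons_of_mem hy)
    rw [Multiset.map_cons, Multiset.count_cons, Multiset.count_cons, ih hs']
    by_cases hxa : x = a
    · subst hxa
      simp
    · have hne : f x ≠ f a := fun h => hxa (hf x a hx ha h)
      simp [hxa, hne]

/-- **Prime-order twist separation (PTS).**  Let `Ω = ∑_{i∈I} E i` be a finite sum of multisets over a field,
`S ≤ Ω`, `ξ ≠ 0`, `1 < m`, exponents `c i < m`, and suppose GENERICITY: no `x, y ∈ Ω` satisfy `x = ξ^k y` with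
`0 < k < m`.  If marking `S` by `ξ` inside `Ω` equals twisting the blocks `E i` by `ξ^{c i}` —
`ξ•S + (Ω − S) = ∑_i ξ^{c i} • E i` — then the marked block is exactly the sum of the blocks of exponent one:
`S = ∑_{i ∈ I, c i = 1} E i`. [new] -/
theorem primeTwistSeparation {F : Type*} [Field F] [DecidableEq F] {ι : Type*} (I : Finset ι)
    (E : ι → Multiset F) (c : ι → ℕ) (Ω S : Multiset F) (ξ : F) (m : ℕ)
    (hm : 1 < m) (hξ : ξ ≠ 0) (hΩ : Ω = ∑ i ∈ I, E i) (hS : S ≤ Ω) (hc : ∀ i ∈ I, c i < m)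
    (hgen : ∀ x ∈ Ω, ∀ y ∈ Ω, ∀ k : ℕ, 0 < k → k < m → x ≠ ξ ^ k * y)
    (hT : S.map (ξ * ·) + (Ω - S) = ∑ i ∈ I, (E i).map (ξ ^ c i * ·)) :
    S = ∑ i ∈ I.filter (fun i => c i = 1), E i := by
  classical
  -- the tagging map and the two tagged multisets
  let f : ℕ × F → F := fun q => ξ ^ q.1 * q.2
  obtain ⟨L, hL⟩ : ∃ L : Multiset (ℕ × F),
      L = S.map (fun s => ((1 : ℕ), s)) + (Ω - S).map (fun r => ((0 : ℕ), r)) := ⟨_, rfl⟩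
  obtain ⟨R, hR⟩ : ∃ R : Multiset (ℕ × F), R = ∑ i ∈ I, (E i).map (fun e => (c i, e)) := ⟨_, rfl⟩
  -- images under the tagging map
  have hLf : L.map f = S.map (ξ * ·) + (Ω - S) := by
    rw [hL, Multiset.map_add, Multiset.map_map, Multiset.map_map]
    have e1 : Multiset.map (f ∘ fun s : F => ((1 : ℕ), s)) S = S.map (ξ * ·) :=
      Multiset.map_congr rfl (fun s _ => by simp [f, Function.comp])
    have e2 : Multiset.map (f ∘ fun r : F => ((0 : ℕ), r)) (Ω - S) = Ω - S := by
      conv_rhs => rw [← Multiset.map_id' (Ω - S)]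
      exact Multiset.map_congr rfl (fun r _ => by simp [f, Function.comp])
    rw [e1, e2]
  have hRf : R.map f = ∑ i ∈ I, (E i).map (ξ ^ c i * ·) := by
    rw [hR, map_finset_sum]
    refine Finset.sum_congr rfl fun i _ => ?_
    rw [Multiset.map_map]
    exact Multiset.map_congr rfl (fun e _ => by simp [f, Function.comp])
  -- every tag lies in `[0,m) × Ω`
  have hLA : ∀ q ∈ L, q.1 < m ∧ q.2 ∈ Ω := by
    intro q hq
    rw [hL, Multiset.mem_add, Multiset.mem_map, Multiset.mem_map] at hq
    rcases hq with ⟨s, hs, rfl⟩ | ⟨r, hr, rfl⟩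
    · exact ⟨hm, Multiset.mem_of_le hS hs⟩
    · exact ⟨lt_trans zero_lt_one hm, Multiset.mem_of_le (Multiset.sub_le_self Ω S) hr⟩
  have hRA : ∀ q ∈ R, q.1 < m ∧ q.2 ∈ Ω := by
    intro q hq
    rw [hR, mem_finset_sum] at hq
    obtain ⟨i, hi, hq⟩ := hq
    rw [Multiset.mem_map] at hq
    obtain ⟨e, he, rfl⟩ := hq
    refine ⟨hc i hi, ?_⟩
    rw [hΩ, mem_finset_sum]
    exact ⟨i, hi, he⟩
  -- the tagging map is injective on `[0,m) × Ω` (this is where genericity is used)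
  have hinj : ∀ q q' : ℕ × F, (q.1 < m ∧ q.2 ∈ Ω) → (q'.1 < m ∧ q'.2 ∈ Ω) → f q = f q' → q = q' := by
    rintro ⟨a, x⟩ ⟨b, y⟩ ⟨ha, hx⟩ ⟨hb, hy⟩ hxy
    simp only [f] at hxy
    simp only at ha hb hx hy
    rcases lt_trichotomy a b with hab | rfl | hab
    · exfalso
      have hx' : x = ξ ^ (b - a) * y := by
        have hξa : ξ ^ a ≠ 0 := pow_ne_zero _ hξ
        apply mul_left_cancel₀ hξa
        rw [hxy, ← mul_assoc, ← pow_add, Nat.add_sub_cancel' hab.le]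
      exact hgen x hx y hy (b - a) (Nat.sub_pos_of_lt hab) (by omega) hx'
    · have hξa : ξ ^ a ≠ 0 := pow_ne_zero _ hξ
      have hxy' : x = y := mul_left_cancel₀ hξa hxy
      rw [hxy']
    · exfalso
      have hy' : y = ξ ^ (a - b) * x := by
        have hξb : ξ ^ b ≠ 0 := pow_ne_zero _ hξ
        apply mul_left_cancel₀ hξb
        rw [← hxy, ← mul_assoc, ← pow_add, Nat.add_sub_cancel' hab.le]
      exact hgen y hy x hx (a - b) (Nat.sub_pos_of_lt hab) (by omega) hy'
  -- hence the tagged multisets agree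
  have hLR : L = R := by
    refine Multiset.ext.mpr fun q => ?_
    by_cases hq : q.1 < m ∧ q.2 ∈ Ω
    · have h1 := count_map_of_injOn f (fun q : ℕ × F => q.1 < m ∧ q.2 ∈ Ω) hinj L hLA q hq
      have h2 := count_map_of_injOn f (fun q : ℕ × F => q.1 < m ∧ q.2 ∈ Ω) hinj R hRA q hq
      rw [← h1, ← h2, hLf, hRf, hT]
    · rw [Multiset.count_eq_zero.mpr (fun h => hq (hLA q h)), Multiset.count_eq_zero.mpr (fun h => hq (hRA q h))]
  -- read off the blocks of tag `1`
  have hL1 : (L.filter (fun q => q.1 = 1)).map Prod.snd = S := by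
    rw [hL, Multiset.filter_add, Multiset.filter_map, Multiset.filter_map]
    have e1 : Multiset.filter ((fun q : ℕ × F => q.1 = 1) ∘ fun s : F => ((1 : ℕ), s)) S = S :=
      Multiset.filter_eq_self.mpr (fun _ _ => rfl)
    have e2 : Multiset.filter ((fun q : ℕ × F => q.1 = 1) ∘ fun r : F => ((0 : ℕ), r)) (Ω - S) = 0 :=
      Multiset.filter_eq_nil.mpr (fun r _ h => by simp [Function.comp] at h)
    rw [e1, e2, Multiset.map_zero, add_zero, Multiset.map_map]
    conv_rhs => rw [← Multiset.map_id' S]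
    exact Multiset.map_congr rfl (fun s _ => rfl)
  have hR1 : (R.filter (fun q => q.1 = 1)).map Prod.snd = ∑ i ∈ I.filter (fun i => c i = 1), E i := by
    rw [hR, filter_finset_sum, map_finset_sum, Finset.sum_filter]
    refine Finset.sum_congr rfl fun i _ => ?_
    rw [Multiset.filter_map]
    by_cases h : c i = 1
    · rw [if_pos h]
      have e1 : Multiset.filter ((fun q : ℕ × F => q.1 = 1) ∘ fun e : F => (c i, e)) (E i) = E i :=
        Multiset.filter_eq_self.mpr (fun _ _ => h)
      rw [e1, Multiset.map_map]
      conv_rhs => rw [← Multiset.map_id' (E i)]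
      exact Multiset.map_congr rfl (fun e _ => rfl)
    · rw [if_neg h]
      have e2 : Multiset.filter ((fun q : ℕ × F => q.1 = 1) ∘ fun e : F => (c i, e)) (E i) = 0 :=
        Multiset.filter_eq_nil.mpr (fun _ _ => h)
      rw [e2, Multiset.map_zero, Multiset.map_zero]
  calc S = (L.filter (fun q => q.1 = 1)).map Prod.snd := hL1.symm
    _ = (R.filter (fun q => q.1 = 1)).map Prod.snd := by rw [hLR]
    _ = ∑ i ∈ I.filter (fun i => c i = 1), E i := hR1

/- Remark (sanity instance (genericity is needed): with one block `E = Ω = {1, ξ, ξ²}`, `m = 3`, `ξ³ = 1`, `c = 0` and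
`S = Ω` the identity `ξ•Ω + 0 = Ω` holds while `S ≠ 0 = ∑_{c i = 1} E i`; so `hgen` cannot be dropped.  Recorded as a
remark; the positive statement above is what the engine uses.) -/

end Summit.Langlands.Langlands.Theorems.PrimeTwistSeparationLadderPTS
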